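import Literature.Analysis.DeBrangesSpaces.BurnolCosineKernelScaling
import Literature.Analysis.DeBrangesSpaces.BurnolXPairingKernelDerivatives
import HarnessLib

/-!
# Burnol 2001 (CRAS 333), §1, proof of Thm. 1.5: the kernel derivatives `∂_w^k C_a(u,w)` are
# analytic in `u` on `(0, ∞)` — holomorphic extension to the right half-plane

Burnol's proof of Théorème 1.5 (TeX l.409–412) uses that "la combinaison linéaire correspondante
des `D_{w,k}(t)` (qui est analytique en `t` sur `]0,∞[`) …", where for `Re w ≤ 1/2` the functions are
`D_{w,k}(t) = (d^k/d^kw) C_λ(t,w)`, `C_a(u,w) = 2∫_a^∞ cos(2πut)t^{w−1}dt` (Lemme 1.3: "`C_a(u,w)`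
est une fonction analytique de `u ∈ ℂ ∖ ]−∞,0]`").  We prove, for EVERY `w ∈ ℂ` and `k ∈ ℕ`, that
`u ↦ ∂_w^k C_a(u,w)` (`u > 0`) is the restriction of a function holomorphic on `Re z > 0`
(`exists_differentiableOn_iteratedDeriv_cosKernel`).  Route (brick 3b of the tree's proof of
`Burnol2001CRAS_thm1_5C`; no contour rotation):

* `iteratedDeriv_cosKernel_one_sub`: `∂_w^m C_a(1,w) − ∂_w^m C_b(1,w) = 2∫_a^b cos(2πs)(log s)^m s^{w−1}ds`
  (the scaling file's `cosKernel_sub_cosKernel`, differentiated `m` times under the integral sign);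
* `iteratedDeriv_cosKernel_eq_sum`: `∂_w^k C_a(u,w) = u^{−w} Σ_i C(k,i)(−log u)^{k−i} ∂_w^i C_{ua}(1,w)`
  (the scaling `C_a(u,w) = u^{−w}C_{ua}(1,w)` and Leibniz' rule for the factor `u^{−w} = e^{−w log u}`);
* `intervalIntegral_cosLogPow_eq`, `differentiableOn_integral_cosLogPow`: the finite integral, after
  the substitution `s = a + θ(b − a)`, extends holomorphically in `b` to `Re b > 0` (dominated
  holomorphic parametric integral, the segment staying in the right half-plane).

RH-FREE (elementary complex analysis; `ζ` does not occur). bears_on: B-C/B-P (COLUMN 6 DBR) as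
tooling only. WHAT THIS IS NOT: not a criterion, not a route; nothing here bears on the truth of RH.

## References
* [Burnol2001CRAS] J.-F. Burnol, C. R. Acad. Sci. Paris 333 (2001) 201–206, §1, Lemme 1.3 and the
  proof of Théorème 1.5 (TeX l.358–367, 409–416).
-/

open MeasureTheory Set Filter Complex Metric Finset
open scoped Real Topology

open Literature.Analysis.DeBrangesSpaces.SonineMellin (cosKernel cosKernel_scaling
  cosKernel_sub_cosKernel differentiable_cosKernel)

namespace Literature.Analysis.DeBrangesSpaces

namespace Burnol2001

/-! ## A. The integrand `cos(2πξ)(log ξ)^m ξ^{ζ−1}` -/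

/-- `ζ`-derivative of `cos(2πs)(log s)^m s^{ζ−1}`: one more logarithm. [folklore] -/
private theorem hasDerivAt_cosLogPow {s : ℝ} (hs : 0 < s) (m : ℕ) (ζ : ℂ) :
    HasDerivAt (fun ζ : ℂ ↦ Complex.cos (2 * π * s) * Complex.log s ^ m * (s : ℂ) ^ (ζ - 1))
      (Complex.cos (2 * π * s) * Complex.log s ^ (m + 1) * (s : ℂ) ^ (ζ - 1)) ζ := by
  have hs0 : (s : ℂ) ≠ 0 := Complex.ofReal_ne_zero.2 hs.ne'
  have h1 : HasDerivAt (fun ζ : ℂ ↦ (s : ℂ) ^ (ζ - 1)) ((s : ℂ) ^ (ζ - 1) * Complex.log s * 1) ζ :=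
    (Complex.hasStrictDerivAt_const_cpow (Or.inl hs0)).hasDerivAt.comp ζ
      ((hasDerivAt_id ζ).sub_const 1)
  have h2 := h1.const_mul (Complex.cos (2 * π * s) * Complex.log s ^ m)
  exact h2.congr_deriv (by rw [pow_succ]; ring)

/-- Continuity of `s ↦ cos(2πs)(log s)^m s^{ζ−1}` on `(0,∞)`. [folklore] -/
private theorem continuousOn_cosLogPow (m : ℕ) (ζ : ℂ) :
    ContinuousOn (fun s : ℝ ↦ Complex.cos (2 * π * s) * Complex.log s ^ m * (s : ℂ) ^ (ζ - 1))
      (Ioi 0) := by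
  intro s hs
  have hs' : (s : ℂ) ∈ slitPlane := Complex.ofReal_mem_slitPlane.2 hs
  refine ContinuousAt.continuousWithinAt ?_
  refine (((Complex.continuous_cos.comp (continuous_const.mul Complex.continuous_ofReal)).continuousAt).mul
    ((ContinuousAt.comp (f := fun x : ℝ ↦ (x : ℂ)) (continuousAt_clog hs')
      Complex.continuous_ofReal.continuousAt).pow m)).mul ?_
  exact Complex.continuousAt_ofReal_cpow_const s (ζ - 1) (Or.inr (ne_of_gt hs))

/-- `‖cos(2πs)‖ ≤ 1` for real `s`. [folklore] -/
private theorem norm_ccos_real_le (s : ℝ) : ‖Complex.cos (2 * π * s)‖ ≤ 1 := by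
  rw [show (2 * π * s : ℂ) = ((2 * π * s : ℝ) : ℂ) by push_cast; ring, ← Complex.ofReal_cos,
    Complex.norm_real, Real.norm_eq_abs]
  exact Real.abs_cos_le_one _

/-- Uniform bound for the integrand on `[lo, hi] ⊂ (0,∞)`:
`‖cos(2πs)(log s)^m s^{ζ−1}‖ ≤ L^m e^{|Re ζ − 1| L}`, `L = max |log lo| |log hi|`. [folklore] -/
private theorem norm_cosLogPow_le {lo hi s : ℝ} (hlo : 0 < lo) (hs : s ∈ Icc lo hi) (m : ℕ) (ζ : ℂ) :
    ‖Complex.cos (2 * π * s) * Complex.log s ^ m * (s : ℂ) ^ (ζ - 1)‖ ≤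
      (max |Real.log lo| |Real.log hi|) ^ m * Real.exp (|(ζ - 1).re| * max |Real.log lo| |Real.log hi|) := by
  set L : ℝ := max |Real.log lo| |Real.log hi| with hL
  have hs0 : 0 < s := hlo.trans_le hs.1
  have hlog : |Real.log s| ≤ L := by
    rw [abs_le]
    constructor
    · calc -L ≤ -|Real.log lo| := neg_le_neg (le_max_left _ _)
        _ ≤ Real.log lo := neg_abs_le _
        _ ≤ Real.log s := Real.log_le_log hlo hs.1
    · calc Real.log s ≤ Real.log hi := Real.log_le_log hs0 hs.2
        _ ≤ |Real.log hi| := le_abs_self _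
        _ ≤ L := le_max_right _ _
  rw [norm_mul, norm_mul, norm_pow, ← Complex.ofReal_log hs0.le, Complex.norm_real,
    Real.norm_eq_abs, Complex.norm_cpow_eq_rpow_re_of_pos hs0, Real.rpow_def_of_pos hs0]
  have h1 : |Real.log s| ^ m ≤ L ^ m := pow_le_pow_left₀ (abs_nonneg _) hlog m
  have h2 : Real.log s * (ζ - 1).re ≤ |(ζ - 1).re| * L := by
    calc Real.log s * (ζ - 1).re ≤ |Real.log s * (ζ - 1).re| := le_abs_self _
      _ = |Real.log s| * |(ζ - 1).re| := abs_mul _ _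
      _ ≤ L * |(ζ - 1).re| := by gcongr
      _ = |(ζ - 1).re| * L := mul_comm _ _
  calc ‖Complex.cos (2 * π * s)‖ * |Real.log s| ^ m * Real.exp (Real.log s * (ζ - 1).re)
      ≤ 1 * L ^ m * Real.exp (|(ζ - 1).re| * L) :=
        mul_le_mul (mul_le_mul (norm_ccos_real_le s) h1 (by positivity) zero_le_one)
          (Real.exp_le_exp.2 h2) (by positivity) (by positivity)
    _ = L ^ m * Real.exp (|(ζ - 1).re| * L) := by rw [one_mul]

/-! ## B. Differentiation under the integral sign on `[a, b]` -/

/-- Points of `Ι a b` are positive and lie in `[min a b, max a b]` when `a, b > 0`. [folklore] -/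
private theorem mem_Icc_of_mem_uIoc {a b t : ℝ} (ht : t ∈ Set.uIoc a b) : t ∈ Icc (min a b) (max a b) :=
  ⟨(Set.mem_uIoc.1 ht).elim (fun h ↦ (min_le_left a b).trans h.1.le)
    (fun h ↦ (min_le_right a b).trans h.1.le),
   (Set.mem_uIoc.1 ht).elim (fun h ↦ h.2.trans (le_max_right a b))
    (fun h ↦ h.2.trans (le_max_left a b))⟩

/-- **`d/dζ ∫_a^b cos(2πs)(log s)^m s^{ζ−1} ds = ∫_a^b cos(2πs)(log s)^{m+1} s^{ζ−1} ds`**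
(`a, b > 0`; dominated differentiation on a compact interval) — the `w`-derivatives of the finite
integrals of Burnol's (1.3)/Lemme 1.3. [cite: Burnol2001CRAS, Lemme 1.3 (TeX l.356–360)] -/
theorem hasDerivAt_integral_cosLogPow {a b : ℝ} (ha : 0 < a) (hb : 0 < b) (m : ℕ) (ζ₀ : ℂ) :
    HasDerivAt (fun ζ : ℂ ↦ ∫ s in a..b, Complex.cos (2 * π * s) * Complex.log s ^ m * (s : ℂ) ^ (ζ - 1))
      (∫ s in a..b, Complex.cos (2 * π * s) * Complex.log s ^ (m + 1) * (s : ℂ) ^ (ζ₀ - 1)) ζ₀ := by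
  set lo : ℝ := min a b with hlo
  set hi : ℝ := max a b with hhi
  have hlo0 : 0 < lo := lt_min ha hb
  set L : ℝ := max |Real.log lo| |Real.log hi| with hL
  set F : ℂ → ℝ → ℂ := fun ζ s ↦ Complex.cos (2 * π * s) * Complex.log s ^ m * (s : ℂ) ^ (ζ - 1)
    with hF
  set F' : ℂ → ℝ → ℂ := fun ζ s ↦ Complex.cos (2 * π * s) * Complex.log s ^ (m + 1) * (s : ℂ) ^ (ζ - 1)
    with hF'
  have hcont : ∀ (n : ℕ) (ζ : ℂ), ContinuousOn
      (fun s : ℝ ↦ Complex.cos (2 * π * s) * Complex.log s ^ n * (s : ℂ) ^ (ζ - 1)) (uIcc a b) := by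
    intro n ζ
    exact (continuousOn_cosLogPow n ζ).mono fun s hs ↦ hlo0.trans_le hs.1
  have hmeas : ∀ (n : ℕ) (ζ : ℂ), AEStronglyMeasurable
      (fun s : ℝ ↦ Complex.cos (2 * π * s) * Complex.log s ^ n * (s : ℂ) ^ (ζ - 1))
      (volume.restrict (Set.uIoc a b)) := by
    intro n ζ
    refine (ContinuousOn.aestronglyMeasurable ((hcont n ζ).mono ?_) measurableSet_uIoc)
    exact uIoc_subset_uIcc
  have key := intervalIntegral.hasDerivAt_integral_of_dominated_loc_of_deriv_le
    (μ := volume) (a := a) (b := b) (F := F) (F' := F') (x₀ := ζ₀) (s := ball ζ₀ 1)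
    (bound := fun _ ↦ L ^ (m + 1) * Real.exp ((‖ζ₀‖ + 2) * L))
    (ball_mem_nhds ζ₀ zero_lt_one) (Eventually.of_forall fun ζ ↦ hmeas m ζ)
    ((hcont m ζ₀).intervalIntegrable) (hmeas (m + 1) ζ₀) ?_ intervalIntegrable_const ?_
  · exact key.2
  · refine Eventually.of_forall fun t ht ζ hζ ↦ ?_
    have htI : t ∈ Icc lo hi := mem_Icc_of_mem_uIoc ht
    refine (norm_cosLogPow_le hlo0 htI (m + 1) ζ).trans ?_
    have hre : |(ζ - 1).re| ≤ ‖ζ₀‖ + 2 := by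
      have h1 : |(ζ - 1).re| ≤ ‖ζ - 1‖ := Complex.abs_re_le_norm _
      have h3 : ‖ζ - ζ₀‖ < 1 := mem_ball_iff_norm.1 hζ
      have h2 : ‖ζ - 1‖ ≤ ‖ζ - ζ₀‖ + ‖ζ₀‖ + 1 := by
        calc ‖ζ - 1‖ = ‖(ζ - ζ₀) + (ζ₀ - 1)‖ := by ring_nf
          _ ≤ ‖ζ - ζ₀‖ + ‖ζ₀ - 1‖ := norm_add_le _ _
          _ ≤ ‖ζ - ζ₀‖ + (‖ζ₀‖ + ‖(1 : ℂ)‖) := by gcongr; exact norm_sub_le _ _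
          _ = ‖ζ - ζ₀‖ + ‖ζ₀‖ + 1 := by rw [norm_one]; ring
      linarith
    have hL0 : 0 ≤ L := le_max_of_le_left (abs_nonneg _)
    gcongr
  · refine Eventually.of_forall fun t ht ζ _ ↦ ?_
    have ht0 : 0 < t := hlo0.trans_le (mem_Icc_of_mem_uIoc ht).1
    exact hasDerivAt_cosLogPow ht0 m ζ

/-! ## C. `∂_w^m C_a(1,w) − ∂_w^m C_b(1,w) = 2∫_a^b cos(2πs)(log s)^m s^{w−1} ds` -/

/-- The case `m = 0`, `a ≤ b`, in interval-integral form. [cite: Burnol2001CRAS, §1 (TeX l.338–355)] -/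
private theorem cosKernel_one_sub_eq_intervalIntegral_of_le {a b : ℝ} (ha : 0 < a) (hab : a ≤ b)
    (ζ : ℂ) : cosKernel a 1 ζ - cosKernel b 1 ζ =
      2 * ∫ s in a..b, Complex.cos (2 * π * s) * Complex.log s ^ 0 * (s : ℂ) ^ (ζ - 1) := by
  rw [cosKernel_sub_cosKernel ha hab ζ, intervalIntegral.integral_of_le hab]
  congr 1
  refine setIntegral_congr_fun measurableSet_Ioc (fun s _ ↦ ?_)
  rw [pow_zero, mul_one, Complex.ofReal_cos]
  push_cast
  ring_nf

/-- **`∂_w^m C_a(1,w) − ∂_w^m C_b(1,w) = 2∫_a^b cos(2πs)(log s)^m s^{w−1} ds`** for `a, b > 0`, every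
`m` and every `w` (for `m = 0` this is the substitution identity `cosKernel_sub_cosKernel`; then
differentiate under the integral sign). [cite: Burnol2001CRAS, §1, Lemme 1.3 (TeX l.338–367)] -/
theorem iteratedDeriv_cosKernel_one_sub {a b : ℝ} (ha : 0 < a) (hb : 0 < b) (m : ℕ) (ζ : ℂ) :
    iteratedDeriv m (cosKernel a 1) ζ - iteratedDeriv m (cosKernel b 1) ζ =
      2 * ∫ s in a..b, Complex.cos (2 * π * s) * Complex.log s ^ m * (s : ℂ) ^ (ζ - 1) := by
  induction m generalizing ζ with
  | zero =>
    rw [iteratedDeriv_zero, iteratedDeriv_zero]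
    rcases le_or_gt a b with hab | hab
    · exact cosKernel_one_sub_eq_intervalIntegral_of_le ha hab ζ
    · have h := cosKernel_one_sub_eq_intervalIntegral_of_le hb hab.le ζ
      rw [intervalIntegral.integral_symm b a, mul_neg, ← h]
      ring
  | succ m ih =>
    have hda : Differentiable ℂ (iteratedDeriv m (cosKernel a 1)) :=
      differentiable_iteratedDeriv_cosKernel ha one_ne_zero m
    have hdb : Differentiable ℂ (iteratedDeriv m (cosKernel b 1)) :=
      differentiable_iteratedDeriv_cosKernel hb one_ne_zero m
    have hfun : (fun ζ ↦ iteratedDeriv m (cosKernel a 1) ζ - iteratedDeriv m (cosKernel b 1) ζ) =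
        fun ζ ↦ 2 * ∫ s in a..b, Complex.cos (2 * π * s) * Complex.log s ^ m * (s : ℂ) ^ (ζ - 1) :=
      funext ih
    have hderiv : deriv (fun ζ ↦ iteratedDeriv m (cosKernel a 1) ζ - iteratedDeriv m (cosKernel b 1) ζ) ζ
        = 2 * ∫ s in a..b, Complex.cos (2 * π * s) * Complex.log s ^ (m + 1) * (s : ℂ) ^ (ζ - 1) := by
      rw [hfun]
      exact ((hasDerivAt_integral_cosLogPow ha hb m ζ).const_mul 2).deriv
    rw [iteratedDeriv_succ, iteratedDeriv_succ, ← hderiv, deriv_fun_sub (hda ζ) (hdb ζ)]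

/-! ## D. Leibniz' rule for the factor `u^{−w}` and the scaling formula for `∂_w^k C_a(u,w)` -/

/-- Leibniz' rule for an exponential factor: for `G` entire and `β ∈ ℂ`,
`(e^{βz}G)^{(n)}(z) = e^{βz} Σ_{i≤n} C(n,i) β^{n−i} G^{(i)}(z)`. [folklore] -/
private theorem iteratedDeriv_cexp_mul {G : ℂ → ℂ} (hG : Differentiable ℂ G) (β : ℂ) (n : ℕ) :
    iteratedDeriv n (fun z ↦ cexp (β * z) * G z) = fun z ↦
      cexp (β * z) * ∑ i ∈ range (n + 1), (n.choose i : ℂ) * β ^ (n - i) * iteratedDeriv i G z := by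
  have hGi : ∀ i : ℕ, Differentiable ℂ (iteratedDeriv i G) := fun i ↦
    hG.contDiff.differentiable_iteratedDeriv i (WithTop.coe_lt_top (i : ℕ∞))
  have hexp : ∀ z : ℂ, HasDerivAt (fun w : ℂ ↦ cexp (β * w)) (cexp (β * z) * β) z := fun z ↦ by
    have h : HasDerivAt (fun w : ℂ ↦ cexp (β * w)) (cexp (β * z) * (β * 1)) z :=
      (Complex.hasDerivAt_exp (β * z)).comp z ((hasDerivAt_id z).const_mul β)
    rwa [mul_one] at h
  induction n with
  | zero => funext z; simp
  | succ n ih =>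
    rw [iteratedDeriv_succ, ih]
    funext z
    have hS : HasDerivAt
        (fun w ↦ ∑ i ∈ range (n + 1), (n.choose i : ℂ) * β ^ (n - i) * iteratedDeriv i G w)
        (∑ i ∈ range (n + 1), (n.choose i : ℂ) * β ^ (n - i) * iteratedDeriv (i + 1) G z) z := by
      refine HasDerivAt.fun_sum fun i _ ↦ ?_
      have h := ((hGi i) z).hasDerivAt
      rw [← iteratedDeriv_succ] at h
      exact h.const_mul _
    have hprod : HasDerivAt
        (fun w ↦ cexp (β * w) * ∑ i ∈ range (n + 1), (n.choose i : ℂ) * β ^ (n - i) * iteratedDeriv i G w)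
        (cexp (β * z) * β * ∑ i ∈ range (n + 1), (n.choose i : ℂ) * β ^ (n - i) * iteratedDeriv i G z +
          cexp (β * z) * ∑ i ∈ range (n + 1), (n.choose i : ℂ) * β ^ (n - i) * iteratedDeriv (i + 1) G z)
        z := (hexp z).mul hS
    have key : ∑ i ∈ range (n + 1 + 1), ((n + 1).choose i : ℂ) * β ^ (n + 1 - i) * iteratedDeriv i G z =
        ∑ i ∈ range (n + 1), (n.choose i : ℂ) * β ^ (n + 1 - i) * iteratedDeriv i G z +
        ∑ i ∈ range (n + 1), (n.choose i : ℂ) * β ^ (n - i) * iteratedDeriv (i + 1) G z := by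
      have h := Finset.sum_choose_succ_mul (fun i j ↦ β ^ j * iteratedDeriv i G z) n
      simpa only [mul_assoc] using h
    rw [hprod.deriv, key, mul_add]
    congr 1
    rw [mul_assoc, Finset.mul_sum]
    congr 1
    refine Finset.sum_congr rfl fun i hi ↦ ?_
    rw [Finset.mem_range] at hi
    rw [show n + 1 - i = (n - i) + 1 by omega, pow_succ]
    ring

/-- **Scaling formula for the kernel derivatives**: for `a, u > 0` and every `w`, `k`,
`∂_w^k C_a(u,w) = u^{−w} Σ_{i≤k} C(k,i) (−log u)^{k−i} ∂_w^i C_{ua}(1,w)`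
(from `C_a(u,w) = u^{−w}C_{ua}(1,w)` and Leibniz' rule). [cite: Burnol2001CRAS, §1 (TeX l.338–367)] -/
theorem iteratedDeriv_cosKernel_eq_sum {a u : ℝ} (ha : 0 < a) (hu : 0 < u) (k : ℕ) (w : ℂ) :
    iteratedDeriv k (cosKernel a u) w = (u : ℂ) ^ (-w) *
      ∑ i ∈ range (k + 1), (k.choose i : ℂ) * (-(Real.log u : ℂ)) ^ (k - i) *
        iteratedDeriv i (cosKernel (u * a) 1) w := by
  have hu0 : (u : ℂ) ≠ 0 := Complex.ofReal_ne_zero.2 hu.ne'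
  have hua : 0 < u * a := mul_pos hu ha
  have hcpow : ∀ ζ : ℂ, (u : ℂ) ^ (-ζ) = cexp (-(Real.log u : ℂ) * ζ) := by
    intro ζ
    rw [Complex.cpow_def_of_ne_zero hu0, ← Complex.ofReal_log hu.le]
    ring_nf
  have hfun : cosKernel a u = fun ζ ↦ cexp (-(Real.log u : ℂ) * ζ) * cosKernel (u * a) 1 ζ := by
    funext ζ
    rw [cosKernel_scaling ha hu ζ, hcpow]
  rw [hfun, iteratedDeriv_cexp_mul (differentiable_cosKernel hua one_ne_zero) _ k]
  dsimp only
  rw [← hcpow]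

/-! ## E. Holomorphic extension in the kernel parameter -/

/-- Real part along the segment from `a > 0` to a point of the right half-plane stays positive.
[folklore] -/
private theorem re_segment_pos {a : ℝ} (ha : 0 < a) {β : ℂ} (hβ : 0 < β.re) {θ : ℝ}
    (hθ : θ ∈ Icc (0 : ℝ) 1) : 0 < ((a : ℂ) + θ * (β - a)).re := by
  have hre : ((a : ℂ) + θ * (β - a)).re = (1 - θ) * a + θ * β.re := by
    simp only [Complex.add_re, Complex.ofReal_re, Complex.re_ofReal_mul, Complex.sub_re]
    ring
  rw [hre]
  have hm : 0 < min a β.re := lt_min ha hβ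
  nlinarith [min_le_left a β.re, min_le_right a β.re, hθ.1, hθ.2]

/-- The integrand is holomorphic on the slit plane. [folklore] -/
private theorem differentiableAt_cosLogPow (m : ℕ) (ζ : ℂ) {ξ : ℂ} (hξ : ξ ∈ slitPlane) :
    DifferentiableAt ℂ (fun ξ : ℂ ↦ Complex.cos (2 * π * ξ) * Complex.log ξ ^ m * ξ ^ (ζ - 1)) ξ := by
  refine ((((differentiable_const _).mul differentiable_id).ccos.differentiableAt).mul
    ((differentiableAt_id.clog hξ).pow m)).mul ?_
  exact differentiableAt_id.cpow_const hξ

/-- **The substitution `s = a + θ(b − a)`**: for `a, b > 0`,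
`∫_a^b cos(2πs)(log s)^m s^{ζ−1} ds = (b − a)∫_0^1 [cos(2πξ)(log ξ)^m ξ^{ζ−1}]_{ξ = a+θ(b−a)} dθ`
(the form in which the `u`-dependence of Lemme 1.3's finite integral is continued to complex `u`).
[cite: Burnol2001CRAS, Lemme 1.3 (TeX l.356–360)] -/
theorem intervalIntegral_cosLogPow_eq {a b : ℝ} (m : ℕ) (ζ : ℂ) :
    ∫ s in a..b, Complex.cos (2 * π * s) * Complex.log s ^ m * (s : ℂ) ^ (ζ - 1) =
      ((b : ℂ) - a) * ∫ θ in (0 : ℝ)..1, Complex.cos (2 * π * ((a : ℂ) + θ * (b - a))) *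
        Complex.log ((a : ℂ) + θ * (b - a)) ^ m * ((a : ℂ) + θ * (b - a)) ^ (ζ - 1) := by
  rcases eq_or_ne b a with rfl | hba
  · simp
  · have hc : b - a ≠ 0 := sub_ne_zero.2 hba
    set g : ℝ → ℂ := fun x ↦ Complex.cos (2 * π * x) * Complex.log x ^ m * (x : ℂ) ^ (ζ - 1) with hg
    have h1 := intervalIntegral.integral_comp_mul_add (f := g) (a := 0) (b := 1) hc a
    have h2 : (fun θ : ℝ ↦ g ((b - a) * θ + a)) = fun θ : ℝ ↦ Complex.cos (2 * π * ((a : ℂ) + θ * (b - a))) *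
        Complex.log ((a : ℂ) + θ * (b - a)) ^ m * ((a : ℂ) + θ * (b - a)) ^ (ζ - 1) := by
      funext θ
      simp only [hg]
      push_cast
      ring_nf
    rw [h2, mul_zero, zero_add, mul_one, sub_add_cancel] at h1
    rw [h1, Complex.real_smul, ← mul_assoc, Complex.ofReal_inv, Complex.ofReal_sub,
      mul_inv_cancel₀ (sub_ne_zero.2 (by exact_mod_cast hba)), one_mul]

/-- **Holomorphy in the endpoint**: for `a > 0`,
`β ↦ ∫_0^1 [cos(2πξ)(log ξ)^m ξ^{ζ−1}]_{ξ = a + θ(β − a)} dθ` is holomorphic on `Re β > 0` (the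
segment from `a` to `β` stays in the right half-plane; dominated holomorphic parametric integral) —
the tree's form of "`C_a(u,w)` … est une fonction analytique de `u ∈ ℂ ∖ ]−∞,0]`" for the finite part.
[cite: Burnol2001CRAS, Lemme 1.3 (TeX l.356–360)] -/
theorem differentiableOn_integral_cosLogPow {a : ℝ} (ha : 0 < a) (m : ℕ) (ζ : ℂ) :
    DifferentiableOn ℂ (fun β : ℂ ↦ ∫ θ in (0 : ℝ)..1, Complex.cos (2 * π * ((a : ℂ) + θ * (β - a))) *
        Complex.log ((a : ℂ) + θ * (β - a)) ^ m * ((a : ℂ) + θ * (β - a)) ^ (ζ - 1))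
      {β : ℂ | 0 < β.re} := by
  set U : Set ℂ := {β : ℂ | 0 < β.re} with hU
  set G : ℂ → ℂ := fun ξ ↦ Complex.cos (2 * π * ξ) * Complex.log ξ ^ m * ξ ^ (ζ - 1) with hG
  have hUo : IsOpen U := isOpen_lt continuous_const Complex.continuous_re
  -- rewrite as a set integral over `Ioc 0 1`
  have hrw : (fun β : ℂ ↦ ∫ θ in (0 : ℝ)..1, Complex.cos (2 * π * ((a : ℂ) + θ * (β - a))) *
      Complex.log ((a : ℂ) + θ * (β - a)) ^ m * ((a : ℂ) + θ * (β - a)) ^ (ζ - 1)) =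
      fun β : ℂ ↦ ∫ θ in Ioc (0 : ℝ) 1, G ((a : ℂ) + θ * (β - a)) := by
    funext β
    rw [intervalIntegral.integral_of_le zero_le_one]
  rw [hrw]
  have hGd : ∀ ξ ∈ slitPlane, DifferentiableAt ℂ G ξ := fun ξ hξ ↦ differentiableAt_cosLogPow m ζ hξ
  -- the affine map `(β, θ) ↦ a + θ(β − a)`
  have hξcont : Continuous fun p : ℂ × ℝ ↦ (a : ℂ) + (p.2 : ℂ) * (p.1 - a) := by fun_prop
  refine Literature.Analysis.Complex.differentiableOn_integral_of_dominated
    (μ := volume.restrict (Ioc (0 : ℝ) 1)) (F := fun (β : ℂ) (θ : ℝ) ↦ G ((a : ℂ) + θ * (β - a)))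
    (U := U) (fun β hβ ↦ ?_) ?_ (fun β₀ hβ₀ ↦ ?_)
  · -- measurability: continuity in `θ` on `Ioc 0 1`
    refine ContinuousOn.aestronglyMeasurable (fun θ hθ ↦ ?_) measurableSet_Ioc
    have hξ : (a : ℂ) + θ * (β - a) ∈ slitPlane :=
      Or.inl (re_segment_pos ha hβ ⟨hθ.1.le, hθ.2⟩)
    exact (ContinuousAt.comp (f := fun θ : ℝ ↦ (a : ℂ) + (θ : ℂ) * (β - a)) (hGd _ hξ).continuousAt
      (by fun_prop : Continuous fun θ : ℝ ↦ (a : ℂ) + (θ : ℂ) * (β - a)).continuousAt).continuousWithinAt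
  · -- holomorphy in `β` for each `θ ∈ (0, 1]`
    filter_upwards [ae_restrict_mem measurableSet_Ioc] with θ hθ
    intro β hβ
    have hξ : (a : ℂ) + θ * (β - a) ∈ slitPlane :=
      Or.inl (re_segment_pos ha hβ ⟨hθ.1.le, hθ.2⟩)
    have haff : DifferentiableAt ℂ (fun β : ℂ ↦ (a : ℂ) + (θ : ℂ) * (β - a)) β := by fun_prop
    exact (DifferentiableAt.comp (f := fun β : ℂ ↦ (a : ℂ) + (θ : ℂ) * (β - a)) β (hGd _ hξ)
      haff).differentiableWithinAt
  · -- domination on a ball, by compactness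
    set R : ℝ := β₀.re / 2 with hR
    have hR0 : 0 < R := by simp only [hU, mem_setOf_eq] at hβ₀; rw [hR]; linarith
    have hballU : ∀ β ∈ closedBall β₀ R, R ≤ β.re := by
      intro β hβ
      have h1 : |(β - β₀).re| ≤ ‖β - β₀‖ := Complex.abs_re_le_norm _
      have h2 : ‖β - β₀‖ ≤ R := mem_closedBall_iff_norm.1 hβ
      rw [Complex.sub_re] at h1
      have := neg_abs_le (β.re - β₀.re)
      simp only [hU, mem_setOf_eq] at hβ₀
      rw [hR] at h2 ⊢
      linarith
    have hsub : ball β₀ R ⊆ U := fun β hβ ↦ by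
      simp only [hU, mem_setOf_eq]
      exact hR0.trans_le (hballU β (ball_subset_closedBall hβ))
    set K : Set (ℂ × ℝ) := closedBall β₀ R ×ˢ Icc (0 : ℝ) 1 with hK
    have hKc : IsCompact K := (isCompact_closedBall β₀ R).prod isCompact_Icc
    have hslit : ∀ p ∈ K, (a : ℂ) + (p.2 : ℂ) * (p.1 - a) ∈ slitPlane := by
      rintro ⟨β, θ⟩ ⟨hβ, hθ⟩
      exact Or.inl (re_segment_pos ha (hR0.trans_le (hballU β hβ)) hθ)
    have hcontK : ContinuousOn (fun p : ℂ × ℝ ↦ G ((a : ℂ) + (p.2 : ℂ) * (p.1 - a))) K :=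
      fun p hp ↦ (ContinuousAt.comp (f := fun p : ℂ × ℝ ↦ (a : ℂ) + (p.2 : ℂ) * (p.1 - a))
        (hGd _ (hslit p hp)).continuousAt hξcont.continuousAt).continuousWithinAt
    obtain ⟨M, hM⟩ := hKc.exists_bound_of_continuousOn hcontK
    refine ⟨R, hR0, hsub, fun _ ↦ M, integrableOn_const (by simp), ?_⟩
    filter_upwards [ae_restrict_mem measurableSet_Ioc] with θ hθ β hβ
    exact hM ⟨β, θ⟩ ⟨ball_subset_closedBall hβ, ⟨hθ.1.le, hθ.2⟩⟩

/-- **Brick 3b of the proof of Théorème 1.5: `u ↦ ∂_w^k C_a(u,w)` is the restriction to `(0,∞)` of a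
function holomorphic on the right half-plane**, for every `a > 0`, `k ∈ ℕ`, `w ∈ ℂ` ("`D_{w,k}(t)` …
est analytique en `t` sur `]0,∞[`", TeX l.410–411; Lemme 1.3: "`C_a(u,w)` est une fonction analytique
de `u ∈ ℂ ∖ ]−∞,0]`").  The extension is
`z ↦ z^{−w} Σ_i C(k,i)(−log z)^{k−i}[∂_w^i C_a(1,w) − 2(za − a)∫_0^1 (cos(2πξ)(log ξ)^i ξ^{w−1})_{ξ=a+θ(za−a)}dθ]`.
[cite: Burnol2001CRAS, Lemme 1.3 and proof of Théorème 1.5 (TeX l.358–360, 409–412)] -/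
theorem exists_differentiableOn_iteratedDeriv_cosKernel {a : ℝ} (ha : 0 < a) (k : ℕ) (w : ℂ) :
    ∃ D : ℂ → ℂ, DifferentiableOn ℂ D {z : ℂ | 0 < z.re} ∧
      ∀ u : ℝ, 0 < u → D u = iteratedDeriv k (cosKernel a u) w := by
  set U : Set ℂ := {z : ℂ | 0 < z.re} with hU
  -- the holomorphic extension of `b ↦ ∂_w^i C_b(1,w)`
  set κ : ℕ → ℂ → ℂ := fun i β ↦ iteratedDeriv i (cosKernel a 1) w -
    2 * ((β - a) * ∫ θ in (0 : ℝ)..1, Complex.cos (2 * π * ((a : ℂ) + θ * (β - a))) *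
      Complex.log ((a : ℂ) + θ * (β - a)) ^ i * ((a : ℂ) + θ * (β - a)) ^ (w - 1)) with hκ
  have hκd : ∀ i, DifferentiableOn ℂ (κ i) U := by
    intro i
    refine (differentiableOn_const _).sub ((differentiableOn_const _).mul ?_)
    exact ((differentiable_id.sub_const _).differentiableOn).mul
      (differentiableOn_integral_cosLogPow ha i w)
  have hκeq : ∀ i, ∀ b : ℝ, 0 < b → κ i b = iteratedDeriv i (cosKernel b 1) w := by
    intro i b hb
    have h := iteratedDeriv_cosKernel_one_sub ha hb i w
    rw [intervalIntegral_cosLogPow_eq i w] at h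
    rw [hκ]; dsimp only
    linear_combination h
  refine ⟨fun z ↦ z ^ (-w) * ∑ i ∈ range (k + 1), (k.choose i : ℂ) * (-Complex.log z) ^ (k - i) *
    κ i (z * a), ?_, fun u hu ↦ ?_⟩
  · have hmaps : MapsTo (fun z : ℂ ↦ z * a) U U := fun z hz ↦ by
      simp only [hU, mem_setOf_eq, Complex.mul_re, Complex.ofReal_re, Complex.ofReal_im, mul_zero,
        sub_zero] at hz ⊢
      exact mul_pos hz ha
    have hslit : ∀ z ∈ U, z ∈ slitPlane := fun z hz ↦ Or.inl hz
    have h1 : DifferentiableOn ℂ (fun z : ℂ ↦ z ^ (-w)) U := fun z hz ↦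
      ((differentiableAt_id (𝕜 := ℂ) (x := z)).cpow_const (hslit z hz)).differentiableWithinAt
    have h2 : ∀ i : ℕ, DifferentiableOn ℂ (fun z : ℂ ↦ (k.choose i : ℂ) * (-Complex.log z) ^ (k - i)) U :=
      fun i z hz ↦ ((((differentiableAt_id (𝕜 := ℂ) (x := z)).clog (hslit z hz)).neg.pow _).const_mul
        _).differentiableWithinAt
    have h3 : ∀ i : ℕ, DifferentiableOn ℂ (fun z : ℂ ↦ κ i (z * a)) U := fun i ↦
      (hκd i).comp ((differentiable_id.mul_const _).differentiableOn) hmaps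
    exact h1.fun_mul (DifferentiableOn.fun_sum fun i _ ↦ (h2 i).fun_mul (h3 i))
  · have hua : 0 < u * a := mul_pos hu ha
    dsimp only
    rw [iteratedDeriv_cosKernel_eq_sum ha hu k w, ← Complex.ofReal_log hu.le]
    congr 1
    refine Finset.sum_congr rfl fun i _ ↦ ?_
    rw [show ((u : ℂ) * a) = ((u * a : ℝ) : ℂ) by push_cast; ring, hκeq i (u * a) hua]

end Burnol2001

end Literature.Analysis.DeBrangesSpaces
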